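import Literature.NumberTheory.LFunctions.WeilFinitePrimeQuadraticChar
import Summits.Ventures.WeilGRH.DualTrigRung
import HarnessLib

/-!
# Keys: the twisted finite-prime Weil form as an AFFINE function of the prime data, and the
# vertex principle (a polytope of certified abstract keys certifies every character inside it)

Cell `rh-explicit`, WEIL TRACK — GRH ARM (Lean root `Summits/Ventures/WeilGRH/`, namespace
`Summit.Ventures.WeilGRH`).  Vocabulary of `WeilExplicitDirichlet.lean` / `WeilFinitePrimeQuadraticChar.lean`
(tests `IsWeilTest = C_c^∞`, `ĝ(1/2+iτ) = weilMellin g (1/2 + τ I)`, rung predicate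
`WeilPositivityOnChar χ t`, analytic form `E_{χ,N}(g) = (1/2π)∫|ĝ(1/2+iτ)|² M_{χ,N}(τ) dτ` with
`M_{χ,N}(τ) = Re ψ(1/4 + a_χ/2 + iτ/2) + (log q − log π) − Σ_{n≤N}(Λ(n)/√n)·2(Re χ(n)cos(τ log n) + Im χ(n)sin(τ log n))`).

**The observation typed here.**  On the window `t = log(N+1)/2` the twisted form depends on `χ` only
through the KEY `(a, L, v) = (charParity χ, log q, (χ(n))_{n ≤ N})` (`weilFinitePrimeWeightChar_eq_key`,
`rfl`), and for a FIXED test function `g` it is an AFFINE function of `(L, v) ∈ ℝ × ℂ^{N+1}`,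
increasing in `L` (`weilFinitePrimeQuadraticKey_convexComb`, `weilFinitePrimeQuadraticKey_mono_left`).
Hence the **vertex principle** (`WeilPositivityOnKey.of_convexComb`): if the abstract keys
`(a, L_j, v_j)` — the `v_j : ℕ → ℂ` are ARBITRARY prime data, not necessarily values of a character, e.g.
of modulus `> 1` — all satisfy window positivity, then so does every key `(a, L, v)` with
`Σ_j w_j L_j ≤ L` and `v(n) = Σ_j w_j v_j(n)` (`n ≤ N`) for convex weights `w`; and therefore
(`weilPositivityOnChar_of_key_convexComb`) every Dirichlet character `χ` mod `q ≠ 1` of parity `a` with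
`(χ(n))_{n≤N}` in the convex hull of the `v_j` and `log q ≥ Σ_j w_j L_j` satisfies the rung
`WeilPositivityOnChar χ (log(N+1)/2)`.  No mesh, no Lipschitz constant: a polytope in key space whose
VERTICES are certified covers all characters of all conductors whose values lie inside it (the cell's
COST-LEVER-A2 §2 L1/L2, made exact).  The certificates at the vertices may come from any sound format;
for the arm's format D-K the soundness statement is re-targeted to keys here
(`weilPositivityOnKey_of_trigDual`: atoms with frequencies `x ≥ log(N+1)` and the pointwise inequality
`0 ≤ M_{a,L,v,N}(τ) + T(τ)`), and D-K certificates combine convexly POINTWISE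
(`trigDual_convexComb`, `weilPositivityOnKey_of_trigDual_convexComb`).

Everything here is PROVED (definitions + theorems); there are no named facts.  Honest scope: nothing in
this file asserts positivity for any key; it is the bookkeeping that turns finitely many certified keys
into a family statement.

## References

* A. Weil, *Sur les "formules explicites" de la théorie des nombres premiers*, Comm. Sém. Math. Univ.
  Lund, tome suppl. (1952) — (11) pp. 261–262 (the prime term is linear in the character values) and
  the «lemme» p. 262 (the hermitian functional).
* H. Yoshida, *On Hermitian forms attached to zeta functions*, Adv. Stud. Pure Math. 21 (1992) — §2
  (2.1) (analytic form on a window: only `p^m ≤ N` enter).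
* R. T. Rockafellar, *Convex Analysis* (1970), §32, Cor. 32.3.2/Thm 32.2 (a concave function attains its
  minimum over a polytope at a vertex) — here in the trivial affine form, proved inline. [folklore]
-/

noncomputable section

open Complex Set MeasureTheory
open scoped Real ArithmeticFunction.vonMangoldt

namespace Summit.Ventures.WeilGRH

open Literature.NumberTheory.LFunctions

variable {q : ℕ} {g : ℝ → ℂ}

/-! ## The key vocabulary -/

/-- The prime ripple of ABSTRACT prime data `v : ℕ → ℂ` on the window `n ≤ N`:
`ρ_{v,N}(τ) = Σ_{n ≤ N} (Λ(n)/√n) · 2(Re v(n) cos(τ log n) + Im v(n) sin(τ log n))`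
(for `v = χ` this is `weilPrimeRippleChar χ N`, `weilPrimeRippleChar_eq_key`). [cite: Weil1952FormulesExplicites, (11) pp. 261–262 (prime term, linear in the character values), read on Re s = 1/2] -/
def weilPrimeRippleKey (v : ℕ → ℂ) (N : ℕ) (τ : ℝ) : ℝ :=
  ∑ n ∈ Finset.range (N + 1), (Λ n : ℝ) / Real.sqrt n *
    (2 * ((v n).re * Real.cos (τ * Real.log n) + (v n).im * Real.sin (τ * Real.log n)))

/-- The finite-prime Weil weight of the KEY `(a, L, v)`: parity `a`, log-conductor `L` (a real
parameter), prime data `v`: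
`M_{a,L,v,N}(τ) = Re ψ(1/4 + a/2 + iτ/2) + (L − log π) − ρ_{v,N}(τ)`
(for a character: `a = charParity χ`, `L = log q`, `v = χ`; `weilFinitePrimeWeightChar_eq_key`).
[cite: Weil1952FormulesExplicites, (11) pp. 261–262 with (5), (10) pp. 254, 258; Yoshida1992, §2 eq. (2.1) (shape)] -/
def weilFinitePrimeWeightKey (a : ℕ) (L : ℝ) (v : ℕ → ℂ) (N : ℕ) (τ : ℝ) : ℝ :=
  (Complex.digamma (1 / 4 + (a : ℂ) / 2 + τ / 2 * I)).re + (L - Real.log π) -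
    weilPrimeRippleKey v N τ

/-- The analytic form of the key: `E_{a,L,v,N}(g) = (1/2π) ∫ |ĝ(1/2+iτ)|² M_{a,L,v,N}(τ) dτ`.
[cite: Yoshida1992, §2 eq. (2.1) (shape); Weil1952FormulesExplicites, (11) at F = g ⋆ g̃ on Re s = 1/2] -/
def weilFinitePrimeQuadraticKey (a : ℕ) (L : ℝ) (v : ℕ → ℂ) (N : ℕ) (g : ℝ → ℂ) : ℝ :=
  1 / (2 * π) * ∫ τ : ℝ, ‖weilMellin g (1 / 2 + τ * I)‖ ^ 2 * weilFinitePrimeWeightKey a L v N τ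

/-- **Window positivity of a key**: `0 ≤ E_{a,L,v,N}(g)` for every smooth `g` supported in
`[−log(N+1)/2, log(N+1)/2]`.  For `(a, L, v) = (charParity χ, log q, χ)` this is the rung
`WeilPositivityOnChar χ (log(N+1)/2)` (`weilPositivityOnChar_iff_key`); for abstract `v` it is the
statement a certificate at a polytope VERTEX proves. [folklore] -/
def WeilPositivityOnKey (a : ℕ) (L : ℝ) (v : ℕ → ℂ) (N : ℕ) : Prop :=
  ∀ g : ℝ → ℂ, IsWeilTest g →
    tsupport g ⊆ Icc (-(Real.log ((N : ℝ) + 1) / 2)) (Real.log ((N : ℝ) + 1) / 2) →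
    0 ≤ weilFinitePrimeQuadraticKey a L v N g

/-! ## Dictionary: a character is the key `(charParity χ, log q, χ)` -/

/-- `ρ_{χ,N} = ρ_{v,N}` with `v = χ`. [folklore] -/
theorem weilPrimeRippleChar_eq_key (χ : DirichletCharacter ℂ q) (N : ℕ) (τ : ℝ) :
    weilPrimeRippleChar χ N τ = weilPrimeRippleKey (fun n ↦ χ (n : ZMod q)) N τ := rfl

/-- `M_{χ,N} = M_{a,L,v,N}` with `a = charParity χ`, `L = log q`, `v = χ`. [folklore] -/
theorem weilFinitePrimeWeightChar_eq_key (χ : DirichletCharacter ℂ q) (N : ℕ) (τ : ℝ) :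
    weilFinitePrimeWeightChar χ N τ =
      weilFinitePrimeWeightKey (charParity χ) (Real.log q) (fun n ↦ χ (n : ZMod q)) N τ := rfl

/-- `E_{χ,N} = E_{a,L,v,N}` with `a = charParity χ`, `L = log q`, `v = χ`. [folklore] -/
theorem weilFinitePrimeQuadraticChar_eq_key (χ : DirichletCharacter ℂ q) (N : ℕ) (g : ℝ → ℂ) :
    weilFinitePrimeQuadraticChar χ N g =
      weilFinitePrimeQuadraticKey (charParity χ) (Real.log q) (fun n ↦ χ (n : ZMod q)) N g := rfl

/-- **The rung of a character is the window positivity of its key** (`χ` mod `q ≠ 1`, any parity,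
imprimitive allowed): `WeilPositivityOnChar χ (log(N+1)/2) ↔ WeilPositivityOnKey (charParity χ) (log q) χ N`.
[folklore] -/
theorem weilPositivityOnChar_iff_key (hq : q ≠ 1) (χ : DirichletCharacter ℂ q) (N : ℕ) :
    WeilPositivityOnChar χ (Real.log ((N : ℝ) + 1) / 2) ↔
      WeilPositivityOnKey (charParity χ) (Real.log q) (fun n ↦ χ (n : ZMod q)) N :=
  weilPositivityOnChar_log_succ_half_iff hq χ N

/-! ## The weight is affine in `(L, v)` and increasing in `L` -/

/-- Only the values `v(n)` at prime powers `n ≤ N` enter (the other terms carry `Λ(n) = 0`). [folklore] -/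
theorem weilPrimeRippleKey_congr {v v' : ℕ → ℂ} {N : ℕ} (h : ∀ n ≤ N, Λ n ≠ 0 → v n = v' n) (τ : ℝ) :
    weilPrimeRippleKey v N τ = weilPrimeRippleKey v' N τ := by
  unfold weilPrimeRippleKey
  refine Finset.sum_congr rfl fun n hn ↦ ?_
  by_cases hΛ : Λ n = 0
  · simp [hΛ]
  · rw [h n (Nat.lt_succ_iff.1 (Finset.mem_range.1 hn)) hΛ]

/-- Only the values `v(n)` at prime powers `n ≤ N` enter the weight. [folklore] -/
theorem weilFinitePrimeWeightKey_congr {v v' : ℕ → ℂ} {N : ℕ} (h : ∀ n ≤ N, Λ n ≠ 0 → v n = v' n)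
    (a : ℕ) (L : ℝ) (τ : ℝ) :
    weilFinitePrimeWeightKey a L v N τ = weilFinitePrimeWeightKey a L v' N τ := by
  unfold weilFinitePrimeWeightKey
  rw [weilPrimeRippleKey_congr h]

/-- **The ripple is linear in the prime data**: for real weights `w_j`,
`ρ_{Σ w_j v_j, N} = Σ w_j ρ_{v_j, N}`. [folklore] -/
theorem weilPrimeRippleKey_convexComb {ι : Type*} (s : Finset ι) (w : ι → ℝ) (v : ι → ℕ → ℂ)
    (N : ℕ) (τ : ℝ) :
    weilPrimeRippleKey (fun n ↦ ∑ j ∈ s, (w j : ℂ) * v j n) N τ =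
      ∑ j ∈ s, w j * weilPrimeRippleKey (v j) N τ := by
  unfold weilPrimeRippleKey
  simp only [Complex.re_sum, Complex.im_sum, Complex.re_ofReal_mul, Complex.im_ofReal_mul]
  have hR : ∑ j ∈ s, w j * ∑ n ∈ Finset.range (N + 1), (Λ n : ℝ) / Real.sqrt n *
      (2 * ((v j n).re * Real.cos (τ * Real.log n) + (v j n).im * Real.sin (τ * Real.log n))) =
      ∑ n ∈ Finset.range (N + 1), ∑ j ∈ s, w j * ((Λ n : ℝ) / Real.sqrt n *
        (2 * ((v j n).re * Real.cos (τ * Real.log n) + (v j n).im * Real.sin (τ * Real.log n)))) := by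
    rw [Finset.sum_comm]
    exact Finset.sum_congr rfl fun j _ ↦ Finset.mul_sum _ _ _
  rw [hR]
  refine Finset.sum_congr rfl fun n _ ↦ ?_
  rw [Finset.sum_mul, Finset.sum_mul, ← Finset.sum_add_distrib, Finset.mul_sum, Finset.mul_sum]
  exact Finset.sum_congr rfl fun j _ ↦ by ring

/-- **The weight is affine in the key**: for weights `w_j` with `Σ w_j = 1`,
`M_{a, Σ w_j L_j, Σ w_j v_j, N} = Σ w_j M_{a, L_j, v_j, N}` pointwise. [folklore] -/
theorem weilFinitePrimeWeightKey_convexComb {ι : Type*} (s : Finset ι) (w : ι → ℝ)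
    (hw : ∑ j ∈ s, w j = 1) (a : ℕ) (L : ι → ℝ) (v : ι → ℕ → ℂ) (N : ℕ) (τ : ℝ) :
    weilFinitePrimeWeightKey a (∑ j ∈ s, w j * L j) (fun n ↦ ∑ j ∈ s, (w j : ℂ) * v j n) N τ =
      ∑ j ∈ s, w j * weilFinitePrimeWeightKey a (L j) (v j) N τ := by
  unfold weilFinitePrimeWeightKey
  rw [weilPrimeRippleKey_convexComb]
  set D : ℝ := (Complex.digamma (1 / 4 + (a : ℂ) / 2 + τ / 2 * I)).re
  have e : ∀ j ∈ s, w j * (D + (L j - Real.log π) - weilPrimeRippleKey (v j) N τ) =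
      w j * D + w j * L j - w j * Real.log π - w j * weilPrimeRippleKey (v j) N τ := fun j _ ↦ by ring
  rw [Finset.sum_congr rfl e, Finset.sum_sub_distrib, Finset.sum_sub_distrib, Finset.sum_add_distrib,
    ← Finset.sum_mul, ← Finset.sum_mul, hw, one_mul, one_mul]
  ring

/-- The weight is increasing in the log-conductor: `M_{a,L,v,N}(τ) + (L' − L) = M_{a,L',v,N}(τ)`. [folklore] -/
theorem weilFinitePrimeWeightKey_add_sub (a : ℕ) (L L' : ℝ) (v : ℕ → ℂ) (N : ℕ) (τ : ℝ) :
    weilFinitePrimeWeightKey a L v N τ + (L' - L) = weilFinitePrimeWeightKey a L' v N τ := by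
  unfold weilFinitePrimeWeightKey; ring

/-! ## Integrability and the analytic form's affinity / monotonicity -/

/-- `τ ↦ |ĝ(1/2+iτ)|² ρ_{v,N}(τ)` is integrable (finitely many bounded spikes against `|ĝ|² = O((1+τ²)⁻²)`). [folklore] -/
theorem integrable_norm_sq_weilMellin_mul_weilPrimeRippleKey (hg : IsWeilTest g) (v : ℕ → ℂ) (N : ℕ) :
    Integrable fun τ : ℝ ↦ ‖weilMellin g (1 / 2 + τ * I)‖ ^ 2 * weilPrimeRippleKey v N τ := by
  have e : (fun τ : ℝ ↦ ‖weilMellin g (1 / 2 + τ * I)‖ ^ 2 * weilPrimeRippleKey v N τ) =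
      fun τ : ℝ ↦ ∑ n ∈ Finset.range (N + 1), (Λ n : ℝ) / Real.sqrt n *
        (‖weilMellin g (1 / 2 + τ * I)‖ ^ 2 *
          (2 * ((v n).re * Real.cos (τ * Real.log n) + (v n).im * Real.sin (τ * Real.log n)))) := by
    funext τ
    unfold weilPrimeRippleKey
    rw [Finset.mul_sum]
    exact Finset.sum_congr rfl fun n _ ↦ by ring
  have hI : ∀ n ∈ Finset.range (N + 1), Integrable fun τ : ℝ ↦ (Λ n : ℝ) / Real.sqrt n *
      (‖weilMellin g (1 / 2 + τ * I)‖ ^ 2 *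
        (2 * ((v n).re * Real.cos (τ * Real.log n) + (v n).im * Real.sin (τ * Real.log n)))) := by
    intro n _
    refine Integrable.const_mul ?_ _
    refine integrable_norm_sq_weilMellin_mul hg (by fun_prop)
      (A := 2 * (|(v n).re| + |(v n).im|)) (B := 0) (by positivity) le_rfl fun τ ↦ ?_
    rw [zero_mul, add_zero, abs_mul, abs_of_pos (by norm_num : (0 : ℝ) < 2)]
    refine mul_le_mul_of_nonneg_left ((abs_add_le _ _).trans (add_le_add ?_ ?_)) (by norm_num)
    · rw [abs_mul]
      exact (mul_le_mul_of_nonneg_left (Real.abs_cos_le_one _) (abs_nonneg _)).trans (by simp)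
    · rw [abs_mul]
      exact (mul_le_mul_of_nonneg_left (Real.abs_sin_le_one _) (abs_nonneg _)).trans (by simp)
  rw [e]
  exact integrable_finsetSum _ hI

/-- The digamma argument `1/4 + a/2 + iτ/2 = x + iτ/2` with the REAL `x = 1/4 + a/2 > 0`. [folklore] -/
private theorem key_digamma_arg (a : ℕ) (τ : ℝ) :
    (1 / 4 + (a : ℂ) / 2 + τ / 2 * I : ℂ) = ((1 / 4 + (a : ℝ) / 2 : ℝ) : ℂ) + τ / 2 * I := by
  push_cast; ring

/-- `τ ↦ |ĝ(1/2+iτ)|² M_{a,L,v,N}(τ)` is integrable. [folklore] -/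
theorem integrable_norm_sq_weilMellin_mul_weilFinitePrimeWeightKey (hg : IsWeilTest g) (a : ℕ) (L : ℝ)
    (v : ℕ → ℂ) (N : ℕ) :
    Integrable fun τ : ℝ ↦ ‖weilMellin g (1 / 2 + τ * I)‖ ^ 2 * weilFinitePrimeWeightKey a L v N τ := by
  have hx : (0 : ℝ) < 1 / 4 + (a : ℝ) / 2 := by positivity
  have h1 := integrable_norm_sq_weilMellin_mul_re_digamma hg hx
  have h2 := (integrable_norm_sq_weilMellin_half_line hg).mul_const (L - Real.log π)
  have h3 := integrable_norm_sq_weilMellin_mul_weilPrimeRippleKey hg v N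
  refine ((h1.add h2).sub h3).congr (Filter.Eventually.of_forall fun τ ↦ ?_)
  simp only [Pi.add_apply, Pi.sub_apply]
  unfold weilFinitePrimeWeightKey
  rw [key_digamma_arg]
  ring

/-- **The analytic form is affine in the key**: for weights with `Σ w_j = 1`,
`E_{a, Σ w_j L_j, Σ w_j v_j, N}(g) = Σ w_j E_{a, L_j, v_j, N}(g)`. [folklore] -/
theorem weilFinitePrimeQuadraticKey_convexComb (hg : IsWeilTest g) {ι : Type*} (s : Finset ι)
    (w : ι → ℝ) (hw : ∑ j ∈ s, w j = 1) (a : ℕ) (L : ι → ℝ) (v : ι → ℕ → ℂ) (N : ℕ) :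
    weilFinitePrimeQuadraticKey a (∑ j ∈ s, w j * L j) (fun n ↦ ∑ j ∈ s, (w j : ℂ) * v j n) N g =
      ∑ j ∈ s, w j * weilFinitePrimeQuadraticKey a (L j) (v j) N g := by
  unfold weilFinitePrimeQuadraticKey
  have hI : ∀ j ∈ s, Integrable fun τ : ℝ ↦
      w j * (‖weilMellin g (1 / 2 + τ * I)‖ ^ 2 * weilFinitePrimeWeightKey a (L j) (v j) N τ) :=
    fun j _ ↦ (integrable_norm_sq_weilMellin_mul_weilFinitePrimeWeightKey hg a (L j) (v j) N).const_mul _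
  have e : (fun τ : ℝ ↦ ‖weilMellin g (1 / 2 + τ * I)‖ ^ 2 *
      weilFinitePrimeWeightKey a (∑ j ∈ s, w j * L j) (fun n ↦ ∑ j ∈ s, (w j : ℂ) * v j n) N τ) =
      fun τ : ℝ ↦ ∑ j ∈ s,
        w j * (‖weilMellin g (1 / 2 + τ * I)‖ ^ 2 * weilFinitePrimeWeightKey a (L j) (v j) N τ) := by
    funext τ
    rw [weilFinitePrimeWeightKey_convexComb s w hw, Finset.mul_sum]
    exact Finset.sum_congr rfl fun j _ ↦ by ring
  rw [e, integral_finsetSum _ hI, Finset.mul_sum]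
  refine Finset.sum_congr rfl fun j _ ↦ ?_
  rw [integral_const_mul]
  ring

/-- **The analytic form is increasing in the log-conductor**:
`E_{a,L',v,N}(g) = E_{a,L,v,N}(g) + (L' − L)‖g‖₂²` (Plancherel `(1/2π)∫|ĝ(1/2+iτ)|² = ‖g‖₂²`). [folklore] -/
theorem weilFinitePrimeQuadraticKey_eq_add_norm (hg : IsWeilTest g) (a : ℕ) (L L' : ℝ) (v : ℕ → ℂ)
    (N : ℕ) :
    weilFinitePrimeQuadraticKey a L' v N g =
      weilFinitePrimeQuadraticKey a L v N g + (L' - L) * weilNorm2Sq g := by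
  unfold weilFinitePrimeQuadraticKey
  have h1 := integrable_norm_sq_weilMellin_mul_weilFinitePrimeWeightKey hg a L v N
  have h2 := (integrable_norm_sq_weilMellin_half_line hg).mul_const (L' - L)
  have e : (fun τ : ℝ ↦ ‖weilMellin g (1 / 2 + τ * I)‖ ^ 2 * weilFinitePrimeWeightKey a L' v N τ) =
      fun τ : ℝ ↦ ‖weilMellin g (1 / 2 + τ * I)‖ ^ 2 * weilFinitePrimeWeightKey a L v N τ +
        ‖weilMellin g (1 / 2 + τ * I)‖ ^ 2 * (L' - L) := by
    funext τ
    rw [← weilFinitePrimeWeightKey_add_sub a L L' v N τ]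
    ring
  rw [e, integral_add h1 h2, integral_mul_const, integral_norm_sq_weilMellin_half_line hg]
  set A : ℝ := ∫ τ : ℝ, ‖weilMellin g (1 / 2 + τ * I)‖ ^ 2 * weilFinitePrimeWeightKey a L v N τ
  have hπ : (π : ℝ) ≠ 0 := Real.pi_ne_zero
  field_simp

/-- Monotonicity in `L`: `L ≤ L' ⟹ E_{a,L,v,N}(g) ≤ E_{a,L',v,N}(g)`. [folklore] -/
theorem weilFinitePrimeQuadraticKey_mono_left (hg : IsWeilTest g) (a : ℕ) {L L' : ℝ} (hL : L ≤ L')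
    (v : ℕ → ℂ) (N : ℕ) :
    weilFinitePrimeQuadraticKey a L v N g ≤ weilFinitePrimeQuadraticKey a L' v N g := by
  rw [weilFinitePrimeQuadraticKey_eq_add_norm hg a L L' v N]
  have := weilNorm2Sq_nonneg g
  nlinarith

/-- Only the values `v(n)` at prime powers `n ≤ N` enter the analytic form. [folklore] -/
theorem weilFinitePrimeQuadraticKey_congr {v v' : ℕ → ℂ} {N : ℕ} (h : ∀ n ≤ N, Λ n ≠ 0 → v n = v' n)
    (a : ℕ) (L : ℝ) (g : ℝ → ℂ) :
    weilFinitePrimeQuadraticKey a L v N g = weilFinitePrimeQuadraticKey a L v' N g := by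
  unfold weilFinitePrimeQuadraticKey
  congr 1
  refine integral_congr_ae (Filter.Eventually.of_forall fun τ ↦ ?_)
  simp only
  rw [weilFinitePrimeWeightKey_congr h]

/-! ## The vertex principle -/

/-- Monotonicity of window positivity in the log-conductor (the conductor is an exact additive shift:
a certified key is a family statement for every larger conductor). [folklore] -/
theorem WeilPositivityOnKey.mono_left {a : ℕ} {L L' : ℝ} (hL : L ≤ L') {v : ℕ → ℂ} {N : ℕ}
    (h : WeilPositivityOnKey a L v N) : WeilPositivityOnKey a L' v N :=
  fun g hg hsupp ↦ (h g hg hsupp).trans (weilFinitePrimeQuadraticKey_mono_left hg a hL v N)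

/-- Window positivity depends only on `v(n)` at the prime powers `n ≤ N`. [folklore] -/
theorem WeilPositivityOnKey.congr {a : ℕ} {L : ℝ} {v v' : ℕ → ℂ} {N : ℕ}
    (hv : ∀ n ≤ N, Λ n ≠ 0 → v n = v' n)
    (h : WeilPositivityOnKey a L v N) : WeilPositivityOnKey a L v' N :=
  fun g hg hsupp ↦ by rw [← weilFinitePrimeQuadraticKey_congr hv a L g]; exact h g hg hsupp

/-- **VERTEX PRINCIPLE.** Let `w_j ≥ 0`, `Σ_j w_j = 1` (a finite convex combination).  If every vertex key
`(a, L_j, v_j)` has window positivity on `n ≤ N`, then so does every key `(a, L, v)` with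
`Σ_j w_j L_j ≤ L` and `v(n) = Σ_j w_j v_j(n)` at the prime powers `n ≤ N`: for each fixed `g` the form is
affine in `(L, v)` and increasing in `L`.  (The `v_j` are arbitrary prime data — they need not be values
of any character, e.g. the vertices of polygons circumscribing the unit circle, one polygon per visible
prime power.) [folklore] -/
theorem WeilPositivityOnKey.of_convexComb {ι : Type*} (s : Finset ι) {w : ι → ℝ}
    (hw0 : ∀ j ∈ s, 0 ≤ w j) (hw1 : ∑ j ∈ s, w j = 1) {a : ℕ} {L : ι → ℝ} {v : ι → ℕ → ℂ} {N : ℕ}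
    (hpos : ∀ j ∈ s, WeilPositivityOnKey a (L j) (v j) N) {L₀ : ℝ} {v₀ : ℕ → ℂ}
    (hL : ∑ j ∈ s, w j * L j ≤ L₀)
    (hv : ∀ n ≤ N, Λ n ≠ 0 → v₀ n = ∑ j ∈ s, (w j : ℂ) * v j n) :
    WeilPositivityOnKey a L₀ v₀ N := by
  have hcomb : WeilPositivityOnKey a (∑ j ∈ s, w j * L j) (fun n ↦ ∑ j ∈ s, (w j : ℂ) * v j n) N := by
    intro g hg hsupp
    rw [weilFinitePrimeQuadraticKey_convexComb hg s w hw1 a L v N]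
    exact Finset.sum_nonneg fun j hj ↦ mul_nonneg (hw0 j hj) (hpos j hj g hg hsupp)
  exact (hcomb.mono_left hL).congr fun n hn hΛ ↦ (hv n hn hΛ).symm

/-- **VERTEX PRINCIPLE for characters.** `χ` mod `q ≠ 1` (any parity, imprimitive allowed) of parity
`a`; vertex keys `(a, L_j, v_j)` with window positivity on `n ≤ N`; convex weights `w` with
`Σ_j w_j L_j ≤ log q` and `χ(n) = Σ_j w_j v_j(n)` at every prime power `n ≤ N` (the same weights for all
`n`: the VECTOR `(χ(n))_n` lies in the convex hull of the vertex vectors).  Then the rung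
`WeilPositivityOnChar χ (log(N+1)/2)` holds — for EVERY conductor `q ≥ exp(Σ_j w_j L_j)` at once. [folklore] -/
theorem weilPositivityOnChar_of_key_convexComb (hq : q ≠ 1) (χ : DirichletCharacter ℂ q) {a : ℕ}
    (ha : charParity χ = a) {N : ℕ} {ι : Type*} (s : Finset ι) {w : ι → ℝ} (hw0 : ∀ j ∈ s, 0 ≤ w j)
    (hw1 : ∑ j ∈ s, w j = 1) {L : ι → ℝ} {v : ι → ℕ → ℂ}
    (hpos : ∀ j ∈ s, WeilPositivityOnKey a (L j) (v j) N) (hL : ∑ j ∈ s, w j * L j ≤ Real.log q)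
    (hv : ∀ n ≤ N, Λ n ≠ 0 → χ (n : ZMod q) = ∑ j ∈ s, (w j : ℂ) * v j n) :
    WeilPositivityOnChar χ (Real.log ((N : ℝ) + 1) / 2) := by
  rw [weilPositivityOnChar_iff_key hq χ N, ha]
  exact WeilPositivityOnKey.of_convexComb s hw0 hw1 hpos hL hv

/-! ## Format D-K re-targeted to keys, and the pointwise convex combination of D-K certificates -/

/-- **LEMMA D-K for keys.** If every atom has frequency `x ≥ log(N+1)` and
`0 ≤ M_{a,L,v,N}(τ) + T(τ)` for EVERY real `τ`, then the key `(a, L, v)` has window positivity on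
`n ≤ N` (the atoms integrate to `0` against `|ĝ(1/2+iτ)|²`,
`integrable_and_integral_norm_sq_weilMellin_mul_trigSum`).  For `v = χ` this is
`weilPositivityOnChar_of_trigDual`. [folklore] -/
theorem weilPositivityOnKey_of_trigDual (a : ℕ) (L : ℝ) (v : ℕ → ℂ) (N : ℕ) (l : List TrigAtom)
    (hx : ∀ A ∈ l, Real.log ((N : ℝ) + 1) ≤ A.x)
    (hP : ∀ τ : ℝ, 0 ≤ weilFinitePrimeWeightKey a L v N τ + trigSum l τ) :
    WeilPositivityOnKey a L v N := by
  intro g hg hsupp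
  set t : ℝ := Real.log ((N : ℝ) + 1) / 2 with ht
  have hx' : ∀ A ∈ l, 2 * t ≤ A.x := fun A hA ↦ by rw [ht]; linarith [hx A hA]
  obtain ⟨hiT, hIT⟩ := integrable_and_integral_norm_sq_weilMellin_mul_trigSum hg hsupp l hx'
  have hiM := integrable_norm_sq_weilMellin_mul_weilFinitePrimeWeightKey hg a L v N
  unfold weilFinitePrimeQuadraticKey
  have hsum : (∫ τ : ℝ, ‖weilMellin g (1 / 2 + τ * I)‖ ^ 2 * weilFinitePrimeWeightKey a L v N τ) =
      ∫ τ : ℝ, ‖weilMellin g (1 / 2 + τ * I)‖ ^ 2 * (weilFinitePrimeWeightKey a L v N τ + trigSum l τ) := by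
    have e : (fun τ : ℝ ↦ ‖weilMellin g (1 / 2 + τ * I)‖ ^ 2 *
        (weilFinitePrimeWeightKey a L v N τ + trigSum l τ)) =
        fun τ : ℝ ↦ ‖weilMellin g (1 / 2 + τ * I)‖ ^ 2 * weilFinitePrimeWeightKey a L v N τ +
          ‖weilMellin g (1 / 2 + τ * I)‖ ^ 2 * trigSum l τ := by
      funext τ; ring
    rw [e, integral_add hiM hiT, hIT, add_zero]
  rw [hsum]
  refine mul_nonneg (by positivity) (integral_nonneg fun τ ↦ ?_)
  exact mul_nonneg (by positivity) (hP τ)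

/-- **Pointwise convex combination of D-K certificates.**  If at each vertex `j ∈ s` the multiplier
inequality `0 ≤ M_{a,L_j,v_j,N}(τ) + T_j(τ)` holds for all `τ`, and `w_j ≥ 0`, `Σ w_j = 1`, then at the
key `(a, L, v)` with `Σ w_j L_j ≤ L`, `v(n) = Σ w_j v_j(n)` (prime powers `n ≤ N`) the inequality
`0 ≤ M_{a,L,v,N}(τ) + Σ_j w_j T_j(τ)` holds for all `τ` — and `Σ_j w_j T_j` is again a multiplier with the
same frequencies (the concatenation of the atom lists with coefficients scaled by `w_j`), so it is a D-K
certificate of the combined key. [folklore] -/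
theorem trigDual_convexComb {ι : Type*} (s : Finset ι) {w : ι → ℝ} (hw0 : ∀ j ∈ s, 0 ≤ w j)
    (hw1 : ∑ j ∈ s, w j = 1) {a : ℕ} {L : ι → ℝ} {v : ι → ℕ → ℂ} {N : ℕ} {l : ι → List TrigAtom}
    (hP : ∀ j ∈ s, ∀ τ : ℝ, 0 ≤ weilFinitePrimeWeightKey a (L j) (v j) N τ + trigSum (l j) τ)
    {L₀ : ℝ} {v₀ : ℕ → ℂ} (hL : ∑ j ∈ s, w j * L j ≤ L₀)
    (hv : ∀ n ≤ N, Λ n ≠ 0 → v₀ n = ∑ j ∈ s, (w j : ℂ) * v j n) (τ : ℝ) :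
    0 ≤ weilFinitePrimeWeightKey a L₀ v₀ N τ + ∑ j ∈ s, w j * trigSum (l j) τ := by
  have e1 : weilFinitePrimeWeightKey a L₀ v₀ N τ =
      weilFinitePrimeWeightKey a (∑ j ∈ s, w j * L j) (fun n ↦ ∑ j ∈ s, (w j : ℂ) * v j n) N τ +
        (L₀ - ∑ j ∈ s, w j * L j) := by
    rw [weilFinitePrimeWeightKey_congr hv, weilFinitePrimeWeightKey_add_sub]
  rw [e1, weilFinitePrimeWeightKey_convexComb s w hw1 a L v N τ]
  have h2 : 0 ≤ ∑ j ∈ s, w j * (weilFinitePrimeWeightKey a (L j) (v j) N τ + trigSum (l j) τ) :=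
    Finset.sum_nonneg fun j hj ↦ mul_nonneg (hw0 j hj) (hP j hj τ)
  have e2 : ∑ j ∈ s, w j * (weilFinitePrimeWeightKey a (L j) (v j) N τ + trigSum (l j) τ) =
      ∑ j ∈ s, w j * weilFinitePrimeWeightKey a (L j) (v j) N τ + ∑ j ∈ s, w j * trigSum (l j) τ := by
    rw [← Finset.sum_add_distrib]
    exact Finset.sum_congr rfl fun j _ ↦ by ring
  rw [e2] at h2
  linarith

/-- **VERTEX PRINCIPLE, D-K form.** D-K certificates (atoms with `x ≥ log(N+1)`, pointwise
inequality) at the vertices `j ∈ s` and convex weights as above give window positivity of every key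
`(a, L, v)` with `Σ w_j L_j ≤ L`, `v(n) = Σ w_j v_j(n)` (prime powers `n ≤ N`). [folklore] -/
theorem weilPositivityOnKey_of_trigDual_convexComb {ι : Type*} (s : Finset ι) {w : ι → ℝ}
    (hw0 : ∀ j ∈ s, 0 ≤ w j) (hw1 : ∑ j ∈ s, w j = 1) {a : ℕ} {L : ι → ℝ} {v : ι → ℕ → ℂ} {N : ℕ}
    {l : ι → List TrigAtom} (hx : ∀ j ∈ s, ∀ A ∈ l j, Real.log ((N : ℝ) + 1) ≤ A.x)
    (hP : ∀ j ∈ s, ∀ τ : ℝ, 0 ≤ weilFinitePrimeWeightKey a (L j) (v j) N τ + trigSum (l j) τ)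
    {L₀ : ℝ} {v₀ : ℕ → ℂ} (hL : ∑ j ∈ s, w j * L j ≤ L₀)
    (hv : ∀ n ≤ N, Λ n ≠ 0 → v₀ n = ∑ j ∈ s, (w j : ℂ) * v j n) :
    WeilPositivityOnKey a L₀ v₀ N :=
  WeilPositivityOnKey.of_convexComb s hw0 hw1
    (fun j hj ↦ weilPositivityOnKey_of_trigDual a (L j) (v j) N (l j) (hx j hj) (hP j hj)) hL hv

end Summit.Ventures.WeilGRH

end
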